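import Summits.NavierStokesRegularity.NavierStokesRegularity.Theorems.AxisymmetricExtremalityAxisymmetricKatoGlobalStubSeregin2020TypeIILemma22CoverTelescoped
import Summits.NavierStokesRegularity.NavierStokesRegularity.Theorems.AxisymmetricExtremalityAxisymmetricKatoGlobalStubSeregin2020TypeIILemma22TrueIntegrands
import Mathlib.MeasureTheory.Measure.Lebesgue.EqHaar
import HarnessLib

/-!
# L22-B, piece F3c (7/·): the energy class of the normalised class-`𝒱` pair, across the axis and `S`

Seregin 2020 Lemma 2.2 ⇐ N–U 2012 Lemma 4.2 for the class `𝒱` (cell ns-inputs, kits A1 item 9, A1-L22B,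
A1-L22B-F3, assembly contract A1-assembly-hEC).  `energyClass_acrossAxis_of_classV_of_excisionErrors`:
for the raw class-`𝒱` data `(U, Φ, S)` of the crux item's `hWH′` and its normalised pair `(Φ̃, Ũ)`
(`Φ̃ = Φ` off `S` for `t<0`, `= k` elsewhere; `Ũ = U` off the axis for `t<0`, `= 0` elsewhere), the
registered v3 `EnergyClass Φ̃ Ũ k R` text holds, GIVEN the excision-error package `hErr`: for every
admissible `(H, Θ, η, t₁, t₂)` a modulus `ω → 0` bounding, for every finite cylinder cover with radii
summing to `≤ ε` and every time partition, the per-piece integrability of the three excision-error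
integrands (kit F3b.4 (e1)(e2)(e3), es-p1 / ser-c) and their sums over the pieces by `ω ε`.
Route P: covers `εₙ = 1/(n+1)` (`exists_finite_cover_meeting`), partitions (`exists_sorted_partition`),
the telescoped inequality of each cover (`cover_telescoped`), dominated convergence for the drift and axis
terms and Fatou for the dissipation through the bad sets (`…CutLimit`), and the abstract limit
`energy_limit_of_cut_approximants` (`ε → 0`, then `σ → 0⁺`).
[cite: NazarovUraltseva2012, §3 (3.9), Remark 9, Lemma 4.2; Seregin2020, Lemma 2.2]

Proving this input makes the conditional line unconditional AS TYPED once `hErr` is discharged; no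
Navier–Stokes regularity statement is proved here.
-/

noncomputable section

set_option linter.dupNamespace false

open MeasureTheory Set Function Filter Topology TopologicalSpace Metric
open scoped NNReal ENNReal InnerProductSpace RealInnerProductSpace

namespace Summit.NavierStokesRegularity.NavierStokesRegularity.Theorems.AxisymmetricKatoGlobal.EulerScaling

open Literature.Analysis.FluidPDE Literature.Analysis.FluidPDE.Seregin2020

/-- Volume of a ball of radius `4ρ`, `0 < ρ < 1`, in `ℝ³`: at most `64 |B(0,1)| ρ`. [folklore] -/
theorem volumeReal_ball_four_mul_le (c : EuclideanSpace ℝ (Fin 3)) {ρ : ℝ} (hρ : 0 < ρ) (hρ1 : ρ < 1) :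
    volume.real (ball c (4 * ρ)) ≤ 64 * volume.real (ball (0 : EuclideanSpace ℝ (Fin 3)) 1) * ρ := by
  have h := Measure.addHaar_ball (volume : Measure (EuclideanSpace ℝ (Fin 3))) c (r := 4 * ρ) (by linarith)
  rw [finrank_euclideanSpace_fin] at h
  have hreal : volume.real (ball c (4 * ρ)) = (4 * ρ) ^ 3 * volume.real (ball (0 : EuclideanSpace ℝ (Fin 3)) 1) := by
    rw [measureReal_def, h, ENNReal.toReal_mul, ENNReal.toReal_ofReal (by positivity), measureReal_def]
  rw [hreal]
  have hB : 0 ≤ volume.real (ball (0 : EuclideanSpace ℝ (Fin 3)) 1) := measureReal_nonneg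
  have hρ3 : ρ ^ 3 ≤ ρ := by nlinarith [mul_pos hρ hρ, hρ.le]
  nlinarith [mul_le_mul_of_nonneg_left hρ3 hB]

/-- **The energy class of the normalised pair, given the excision-error package** (module docstring). -/
theorem energyClass_acrossAxis_of_classV_of_excisionErrors
    {U U' : ℝ → EuclideanSpace ℝ (Fin 3) → EuclideanSpace ℝ (Fin 3)} {Φ Φ' : ℝ → EuclideanSpace ℝ (Fin 3) → ℝ}
    {S : Set (ℝ × EuclideanSpace ℝ (Fin 3))} {R k : ℝ}
    (hUc : ContinuousOn (uncurry U) {z : ℝ × EuclideanSpace ℝ (Fin 3) | z.1 < 0 ∧ cylRadius z.2 ≠ 0})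
    (hUs : ∀ z : ℝ × EuclideanSpace ℝ (Fin 3), z.1 < 0 → cylRadius z.2 ≠ 0 → ContDiffAt ℝ (⊤ : ℕ∞) (U z.1) z.2)
    (hdivU : ∀ z : ℝ × EuclideanSpace ℝ (Fin 3), z.1 < 0 → cylRadius z.2 ≠ 0 →
      VectorCalculus.divergence (U z.1) z.2 = 0)
    (hU3 : ∀ a : ℝ, 0 < a → ∫⁻ z in parabolicCylinder a (0 : ℝ × EuclideanSpace ℝ (Fin 3)), ‖U z.1 z.2‖ₑ ^ (3 : ℕ) < ∞)
    (hSc : IsClosed S) (hSax : ∀ z ∈ S, z.1 ≤ 0 ∧ cylRadius z.2 = 0) (hSP : IsParabolicNull 1 S)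
    (hΦc : ContinuousOn (uncurry Φ) ({z : ℝ × EuclideanSpace ℝ (Fin 3) | z.1 < 0} \ S))
    (hΦs : ∀ z : ℝ × EuclideanSpace ℝ (Fin 3), z.1 < 0 → z ∉ S → ContDiffAt ℝ (⊤ : ℕ∞) (Φ z.1) z.2)
    (hΦg : ContinuousOn (fun z : ℝ × EuclideanSpace ℝ (Fin 3) => fderiv ℝ (Φ z.1) z.2)
      ({z : ℝ × EuclideanSpace ℝ (Fin 3) | z.1 < 0} \ S))
    (hΦt : ∀ z : ℝ × EuclideanSpace ℝ (Fin 3), z.1 < 0 → cylRadius z.2 ≠ 0 → DifferentiableAt ℝ (fun r => Φ r z.2) z.1)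
    (hΦt' : ContinuousOn (fun z : ℝ × EuclideanSpace ℝ (Fin 3) => deriv (fun r => Φ r z.2) z.1)
      {z : ℝ × EuclideanSpace ℝ (Fin 3) | z.1 < 0 ∧ cylRadius z.2 ≠ 0})
    (hΦ0 : ∀ z : ℝ × EuclideanSpace ℝ (Fin 3), z.1 < 0 → z ∉ S → 0 ≤ Φ z.1 z.2)
    (hsup : ∀ z : ℝ × EuclideanSpace ℝ (Fin 3), z.1 < 0 → cylRadius z.2 ≠ 0 →
      0 ≤ deriv (fun r => Φ r z.2) z.1 + fderiv ℝ (Φ z.1) z.2 (U z.1 z.2) +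
          2 / cylRadius z.2 * partialDeriv (eR z.2) (Φ z.1) z.2 - (Laplacian.laplacian (Φ z.1)) z.2)
    (hR : 0 < R) (hk0 : 0 < k)
    (hk : ∀ z : ℝ × EuclideanSpace ℝ (Fin 3), z.1 ∈ Ioo (-R ^ 2) 0 → cylRadius z.2 = 0 →
      z.2 2 ∈ Ioo (-(2 * R)) (2 * R) → z ∉ S → k ≤ Φ z.1 z.2)
    (hΦ'1 : ∀ t x, t < 0 → (t, x) ∉ S → Φ' t x = Φ t x) (hΦ'2 : ∀ t x, ¬ (t < 0 ∧ (t, x) ∉ S) → Φ' t x = k)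
    (hU'1 : ∀ t x, t < 0 → cylRadius x ≠ 0 → U' t x = U t x) (hU'2 : ∀ t x, ¬ (t < 0 ∧ cylRadius x ≠ 0) → U' t x = 0)
    -- the excision-error package (kit F3b.4 (e1)(e2)(e3) summed over the pieces of any cover)
    (hErr : ∀ (H : ℝ → ℝ), ContDiff ℝ 2 H → (∀ v, deriv H v ≤ 0) → (∀ v, 0 ≤ H v) → (∀ v, k ≤ v → H v = 0) →
      ∀ (Θ : EuclideanSpace ℝ (Fin 3) → ℝ), ContDiff ℝ 1 Θ → HasCompactSupport Θ →
        tsupport Θ ⊆ ball (0 : EuclideanSpace ℝ (Fin 3)) (2 * R) →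
      ∀ (η : ℝ → ℝ), ContDiff ℝ 1 η → (∀ s, 0 ≤ η s) →
      ∀ (t₁ t₂ : ℝ), -R ^ 2 < t₁ → t₁ ≤ t₂ → t₂ < 0 →
      ∃ ω : ℝ → ℝ, Tendsto ω (𝓝[>] 0) (𝓝 0) ∧
        ∀ (s : Finset ℕ) (z : ℕ → ℝ × EuclideanSpace ℝ (Fin 3)) (r : ℕ → ℝ) (ε : ℝ), 0 < ε →
          (∀ i ∈ s, 0 < r i ∧ r i < 1) → ∑ i ∈ s, r i ≤ ε →
        ∀ (p : ℕ) (τ : ℕ → ℝ), Monotone τ → τ 0 = t₁ → τ p = t₂ →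
        ∀ (A : ℕ → Finset ℕ), (∀ m, A m = s.filter fun i => (z i).1 - 2 * r i ^ 2 ≤ τ m ∧ τ (m + 1) ≤ (z i).1 + 2 * r i ^ 2) →
        ∀ (φ : ℕ → EuclideanSpace ℝ (Fin 3) → ℝ), (∀ m y, φ m y = ∏ i ∈ A m, (1 - cutoff (2 * r i) (y - (z i).2))) →
          (∀ m < p,
            Integrable (fun w : ℝ × EuclideanSpace ℝ (Fin 3) =>
                η w.1 * (H (Φ' w.1 w.2) * (Θ w.2 ^ 2 * ‖gradient (φ m) w.2‖ ^ 2)))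
              (volume.restrict (Icc (τ m) (τ (m + 1)) ×ˢ (univ : Set (EuclideanSpace ℝ (Fin 3))))) ∧
            Integrable (fun w : ℝ × EuclideanSpace ℝ (Fin 3) =>
                η w.1 * (H (Φ' w.1 w.2) * inner ℝ (U' w.1 w.2) ((Θ w.2 ^ 2) • gradient (fun y => φ m y ^ 2) w.2)))
              (volume.restrict (Icc (τ m) (τ (m + 1)) ×ˢ (univ : Set (EuclideanSpace ℝ (Fin 3))))) ∧
            Integrable (fun w : ℝ × EuclideanSpace ℝ (Fin 3) =>
                η w.1 * (2 / cylRadius w.2 * (H (Φ' w.1 w.2) * (Θ w.2 ^ 2 * fderiv ℝ (fun y => φ m y ^ 2) w.2 (eR w.2)))))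
              (volume.restrict (Icc (τ m) (τ (m + 1)) ×ˢ (univ : Set (EuclideanSpace ℝ (Fin 3)))))) ∧
          (∑ m ∈ Finset.range p, ∫ w in Icc (τ m) (τ (m + 1)) ×ˢ (univ : Set (EuclideanSpace ℝ (Fin 3))),
              η w.1 * (H (Φ' w.1 w.2) * (Θ w.2 ^ 2 * ‖gradient (φ m) w.2‖ ^ 2))) ≤ ω ε ∧
          (∑ m ∈ Finset.range p, ∫ w in Icc (τ m) (τ (m + 1)) ×ˢ (univ : Set (EuclideanSpace ℝ (Fin 3))),
              η w.1 * (H (Φ' w.1 w.2) * |inner ℝ (U' w.1 w.2) ((Θ w.2 ^ 2) • gradient (fun y => φ m y ^ 2) w.2)|)) ≤ ω ε ∧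
          (∑ m ∈ Finset.range p, ∫ w in Icc (τ m) (τ (m + 1)) ×ˢ (univ : Set (EuclideanSpace ℝ (Fin 3))),
              η w.1 * (2 / cylRadius w.2 * (H (Φ' w.1 w.2) * |Θ w.2 ^ 2 * fderiv ℝ (fun y => φ m y ^ 2) w.2 (eR w.2)|))) ≤ ω ε) :
    ∀ (H : ℝ → ℝ), ContDiff ℝ 2 H → (∀ v, deriv H v ≤ 0) → (∀ v, 0 ≤ H v) →
      (∀ v, 0 ≤ deriv (deriv H) v) → (∀ v, deriv H v ^ 2 ≤ 2 * H v * deriv (deriv H) v) →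
      (∀ v, k ≤ v → H v = 0) →
    ∀ (Θ : EuclideanSpace ℝ (Fin 3) → ℝ), ContDiff ℝ 1 Θ → HasCompactSupport Θ →
      tsupport Θ ⊆ ball (0 : EuclideanSpace ℝ (Fin 3)) (2 * R) →
    ∀ (η : ℝ → ℝ), ContDiff ℝ 1 η → (∀ s, 0 ≤ η s) →
    ∀ (t₁ t₂ : ℝ), -R ^ 2 < t₁ → t₁ ≤ t₂ → t₂ < 0 →
      ENNReal.ofReal (η t₂ * ∫ x, H (Φ' t₂ x) * Θ x ^ 2) +
        ∫⁻ z in Icc t₁ t₂ ×ˢ (univ : Set (EuclideanSpace ℝ (Fin 3))), ENNReal.ofReal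
          (1 / 2 * η z.1 * (deriv (deriv H) (Φ' z.1 z.2) * ‖gradient (Φ' z.1) z.2‖ ^ 2 * Θ z.2 ^ 2))
      ≤ ENNReal.ofReal (η t₁ * (∫ x, H (Φ' t₁ x) * Θ x ^ 2) +
          (4 * ∫ z in Icc t₁ t₂ ×ˢ (univ : Set (EuclideanSpace ℝ (Fin 3))),
            η z.1 * (H (Φ' z.1 z.2) * ‖gradient Θ z.2‖ ^ 2)) +
          (∫ z in Icc t₁ t₂ ×ˢ (univ : Set (EuclideanSpace ℝ (Fin 3))),
            η z.1 * (H (Φ' z.1 z.2) * inner ℝ (U' z.1 z.2) (gradient (fun y => Θ y ^ 2) z.2))) +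
          (∫ z in Icc t₁ t₂ ×ˢ (univ : Set (EuclideanSpace ℝ (Fin 3))),
            η z.1 * (2 / cylRadius z.2 * (H (Φ' z.1 z.2) * fderiv ℝ (fun y => Θ y ^ 2) z.2 (eR z.2)))) +
          (∫ z in Icc t₁ t₂ ×ˢ (univ : Set (EuclideanSpace ℝ (Fin 3))), |deriv η z.1| * (H (Φ' z.1 z.2) * Θ z.2 ^ 2))) := by
  classical
  intro H hH hH' hH0 hH2 hκ hHk Θ hΘ hΘc hΘO η hη hη0 t₁ t₂ ht₁ h12 ht₂
  -- ### constants
  obtain ⟨CΘ, hCΘ'⟩ := hΘ.continuous.bounded_above_of_compact_support hΘc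
  have hCΘ : ∀ y, |Θ y| ≤ CΘ := fun y => by rw [← Real.norm_eq_abs]; exact hCΘ' y
  obtain ⟨Cη', hCη'⟩ := isCompact_Icc.exists_bound_of_continuousOn (hη.continuous.continuousOn (s := Icc t₁ t₂))
  have hCη : ∀ t ∈ Icc t₁ t₂, η t ≤ Cη' := fun t ht => (le_abs_self _).trans (by
    rw [← Real.norm_eq_abs]; exact hCη' t ht)
  set Kc : ℝ := Cη' * (H 0 * CΘ ^ 2) with hKc
  set vB : ℝ := volume.real (ball (0 : EuclideanSpace ℝ (Fin 3)) 1) with hvB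
  have hvB0 : 0 ≤ vB := measureReal_nonneg
  have hKc0 : 0 ≤ Kc := mul_nonneg ((hη0 t₁).trans (hCη t₁ ⟨le_rfl, h12⟩)) (mul_nonneg (hH0 0) (sq_nonneg _))
  -- ### the error modulus
  obtain ⟨ω, hω, hωb⟩ := hErr H hH hH' hH0 hHk Θ hΘ hΘc hΘO η hη hη0 t₁ t₂ ht₁ h12 ht₂
  -- ### true integrands
  obtain ⟨iT1, iT2, iT3, iT4, -, mD⟩ := integrable_energyClassIntegrands_normalised hUc hU3 hSc hSax hΦc hΦg hΦ0 hR hk0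
    hΦ'1 hΦ'2 hU'1 hU'2 hH hH' hH0 hΘ hΘc hΘO hη ht₁ ht₂
  -- ### the covers `εₙ = 1/(n+1)` and their bumps
  set ε : ℕ → ℝ := fun n => 1 / ((n : ℝ) + 1) with hε
  have hε0 : ∀ n, 0 < ε n := fun n => by rw [hε]; positivity
  have hK : IsCompact (Icc t₁ t₂ ×ˢ closedBall (0 : EuclideanSpace ℝ (Fin 3)) (2 * R)) :=
    isCompact_Icc.prod (isCompact_closedBall _ _)
  choose s z r hr hcov hsum hmeet using fun n : ℕ => exists_finite_cover_meeting hSP hSc hK (hε0 n)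
  obtain ⟨C₀, -, hbump⟩ := exists_ballBump_const
  set ψ : ℕ → ℕ → EuclideanSpace ℝ (Fin 3) → ℝ := fun n i y => cutoff (2 * r n i) (y - (z n i).2) with hψ
  have hψC : ∀ n, ∀ i ∈ s n, ContDiff ℝ 1 (ψ n i) := fun n i hi => (hbump (z n i).2 (r n i) (hr n i hi).1).1
  have hψ01 : ∀ n, ∀ i ∈ s n, ∀ y, 0 ≤ ψ n i y ∧ ψ n i y ≤ 1 := fun n i hi => (hbump (z n i).2 (r n i) (hr n i hi).1).2.1
  have hψ1 : ∀ n, ∀ i ∈ s n, ∀ y ∈ closedBall (z n i).2 (2 * r n i), ψ n i y = 1 :=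
    fun n i hi => (hbump (z n i).2 (r n i) (hr n i hi).1).2.2.1
  have hψ0 : ∀ n, ∀ i ∈ s n, ∀ y, y ∉ ball (z n i).2 (4 * r n i) → ψ n i y = 0 :=
    fun n i hi => (hbump (z n i).2 (r n i) (hr n i hi).1).2.2.2.1
  -- ### the partitions
  choose p τ hτ hτ0 hτp' hτlt hτI hτE using fun n : ℕ => exists_sorted_partition
    ((s n).image (fun i => (z n i).1 - 2 * r n i ^ 2) ∪ (s n).image (fun i => (z n i).1 + 2 * r n i ^ 2)) h12
  have hτp : ∀ n, τ n (p n) = t₂ := fun n => hτp' n (p n) le_rfl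
  have hτE' : ∀ n, ∀ m < p n, ∀ i ∈ s n, (z n i).1 - 2 * r n i ^ 2 ∉ Ioo (τ n m) (τ n (m + 1)) ∧
      (z n i).1 + 2 * r n i ^ 2 ∉ Ioo (τ n m) (τ n (m + 1)) := fun n m hm i hi =>
    ⟨hτE n m hm _ (Finset.mem_union_left _ (Finset.mem_image_of_mem _ hi)),
      hτE n m hm _ (Finset.mem_union_right _ (Finset.mem_image_of_mem _ hi))⟩
  -- ### active sets and cut-offs
  set A : ℕ → ℕ → Finset ℕ := fun n m => (s n).filter fun i =>
    (z n i).1 - 2 * r n i ^ 2 ≤ τ n m ∧ τ n (m + 1) ≤ (z n i).1 + 2 * r n i ^ 2 with hA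
  set φ : ℕ → ℕ → EuclideanSpace ℝ (Fin 3) → ℝ := fun n m y => ∏ i ∈ A n m, (1 - ψ n i y) with hφ
  have hAs : ∀ n m, A n m ⊆ s n := fun n m => Finset.filter_subset _ _
  have hφ0 : ∀ n m y, 0 ≤ φ n m y := fun n m y => prodCut_nonneg fun i hi => (hψ01 n i (hAs n m hi) y).2
  have hφ1 : ∀ n m y, φ n m y ≤ 1 := fun n m y =>
    prodCut_le_one (fun i hi => (hψ01 n i (hAs n m hi) y).1) fun i hi => (hψ01 n i (hAs n m hi) y).2
  have hφC : ∀ n m, Continuous (φ n m) := fun n m => (contDiff_prodCut fun i hi => hψC n i (hAs n m hi)).continuous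
  -- ### the bad sets; the cut-offs equal `1` off them during their piece
  set Bad : ℕ → Set (ℝ × EuclideanSpace ℝ (Fin 3)) := fun n => ⋃ i ∈ s n,
    Icc ((z n i).1 - 2 * r n i ^ 2) ((z n i).1 + 2 * r n i ^ 2) ×ˢ ball (z n i).2 (4 * r n i) with hBad
  have hBadm : ∀ n, MeasurableSet (Bad n) := fun n => measurableSet_badSet (s n) (z n) (r n)
  have hφBad : ∀ n m (w : ℝ × EuclideanSpace ℝ (Fin 3)), w.1 ∈ Icc (τ n m) (τ n (m + 1)) → w ∉ Bad n →
      φ n m w.2 = 1 := by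
    intro n m w hw hwB
    refine prodCut_eq_one fun i hi => ?_
    have hi' := Finset.mem_filter.1 hi
    refine hψ0 n i hi'.1 w.2 fun hball => hwB ?_
    have hmem : w ∈ Icc ((z n i).1 - 2 * r n i ^ 2) ((z n i).1 + 2 * r n i ^ 2) ×ˢ ball (z n i).2 (4 * r n i) :=
      ⟨⟨hi'.2.1.trans hw.1, hw.2.trans hi'.2.2⟩, hball⟩
    exact mem_iUnion₂.2 ⟨i, hi'.1, hmem⟩
  have hevBad : ∀ᵐ w ∂(volume.restrict (Icc t₁ t₂ ×ˢ (univ : Set (EuclideanSpace ℝ (Fin 3))))),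
      ∀ᶠ n in atTop, w ∉ Bad n := by
    have hS0 : volume S = 0 := by
      refine measure_mono_null (t := (univ : Set ℝ) ×ˢ {x : EuclideanSpace ℝ (Fin 3) | cylRadius x = 0})
        (fun w hw => ⟨mem_univ w.1, (hSax w hw).2⟩) ?_
      rw [show (volume : Measure (ℝ × EuclideanSpace ℝ (Fin 3))) = (volume : Measure ℝ).prod volume from rfl,
        Measure.prod_prod, volume_setOf_cylRadius_eq_zero, mul_zero]
    have hae : ∀ᵐ w ∂(volume : Measure (ℝ × EuclideanSpace ℝ (Fin 3))), w ∉ S :=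
      measure_eq_zero_iff_ae_notMem.1 hS0
    filter_upwards [ae_restrict_of_ae hae] with w hw
    have hC : IsClosed (S ∩ (Icc t₁ t₂ ×ˢ closedBall (0 : EuclideanSpace ℝ (Fin 3)) (2 * R))) := hSc.inter hK.isClosed
    exact eventually_notMem_badSet hC hr hsum hmeet
      (by rw [hε]; exact tendsto_one_div_add_atTop_nhds_zero_nat) (fun h => hw h.1)
  -- ### the error package of each cover
  have herr : ∀ n, (∀ m < p n,
      Integrable (fun w : ℝ × EuclideanSpace ℝ (Fin 3) =>
          η w.1 * (H (Φ' w.1 w.2) * (Θ w.2 ^ 2 * ‖gradient (φ n m) w.2‖ ^ 2)))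
        (volume.restrict (Icc (τ n m) (τ n (m + 1)) ×ˢ (univ : Set (EuclideanSpace ℝ (Fin 3))))) ∧
      Integrable (fun w : ℝ × EuclideanSpace ℝ (Fin 3) =>
          η w.1 * (H (Φ' w.1 w.2) * inner ℝ (U' w.1 w.2) ((Θ w.2 ^ 2) • gradient (fun y => φ n m y ^ 2) w.2)))
        (volume.restrict (Icc (τ n m) (τ n (m + 1)) ×ˢ (univ : Set (EuclideanSpace ℝ (Fin 3))))) ∧
      Integrable (fun w : ℝ × EuclideanSpace ℝ (Fin 3) =>
          η w.1 * (2 / cylRadius w.2 * (H (Φ' w.1 w.2) * (Θ w.2 ^ 2 * fderiv ℝ (fun y => φ n m y ^ 2) w.2 (eR w.2)))))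
        (volume.restrict (Icc (τ n m) (τ n (m + 1)) ×ˢ (univ : Set (EuclideanSpace ℝ (Fin 3)))))) ∧
    (∑ m ∈ Finset.range (p n), ∫ w in Icc (τ n m) (τ n (m + 1)) ×ˢ (univ : Set (EuclideanSpace ℝ (Fin 3))),
        η w.1 * (H (Φ' w.1 w.2) * (Θ w.2 ^ 2 * ‖gradient (φ n m) w.2‖ ^ 2))) ≤ ω (ε n) ∧
    (∑ m ∈ Finset.range (p n), ∫ w in Icc (τ n m) (τ n (m + 1)) ×ˢ (univ : Set (EuclideanSpace ℝ (Fin 3))),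
        η w.1 * (H (Φ' w.1 w.2) * |inner ℝ (U' w.1 w.2) ((Θ w.2 ^ 2) • gradient (fun y => φ n m y ^ 2) w.2)|)) ≤ ω (ε n) ∧
    (∑ m ∈ Finset.range (p n), ∫ w in Icc (τ n m) (τ n (m + 1)) ×ˢ (univ : Set (EuclideanSpace ℝ (Fin 3))),
        η w.1 * (2 / cylRadius w.2 * (H (Φ' w.1 w.2) * |Θ w.2 ^ 2 * fderiv ℝ (fun y => φ n m y ^ 2) w.2 (eR w.2)|)))
      ≤ ω (ε n) :=
    fun n => hωb (s n) (z n) (r n) (ε n) (hε0 n) (hr n) (hsum n) (p n) (τ n) (hτ n) (hτ0 n) (hτp n) (A n)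
      (fun m => rfl) (φ n) (fun m y => rfl)
  -- ### the telescoped inequality of each cover
  have htel : ∀ n, ∀ σ : ℝ, 0 < σ → _ := fun n σ hσ =>
    cover_telescoped hUc hUs hdivU hU3 hSc hSax hΦc hΦs hΦg hΦt hΦt' hΦ0 hsup hR hk0 hk hΦ'1 hΦ'2 hU'1
      hH hH' hH0 hH2 hκ hHk hΘ hΘc hΘO hCΘ hη hη0 ht₁ ht₂ hCη hσ (fun i hi => (hr n i hi).1) (hcov n) (hψC n) (hψ01 n)
      (hψ1 n) (hψ0 n) (hτ n) (hτ0 n) (hτp n) (hτE' n) (A := A n) (fun m => rfl) (φ := φ n) (fun m y => rfl)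
      iT1 iT2 iT3 iT4 (fun m hm => ((herr n).1 m hm).1) (fun m hm => ((herr n).1 m hm).2.1)
      (fun m hm => ((herr n).1 m hm).2.2)

  -- ### shorthand for the integrands
  set μ : Measure (ℝ × EuclideanSpace ℝ (Fin 3)) :=
    volume.restrict (Icc t₁ t₂ ×ˢ (univ : Set (EuclideanSpace ℝ (Fin 3)))) with hμ
  set T2 : ℝ × EuclideanSpace ℝ (Fin 3) → ℝ := fun w =>
    η w.1 * (H (Φ' w.1 w.2) * inner ℝ (U' w.1 w.2) (gradient (fun y => Θ y ^ 2) w.2)) with hT2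
  set T3 : ℝ × EuclideanSpace ℝ (Fin 3) → ℝ := fun w =>
    η w.1 * (2 / cylRadius w.2 * (H (Φ' w.1 w.2) * fderiv ℝ (fun y => Θ y ^ 2) w.2 (eR w.2))) with hT3
  set dd : ℝ × EuclideanSpace ℝ (Fin 3) → ℝ := fun w =>
    1 / 2 * η w.1 * (deriv (deriv H) (Φ' w.1 w.2) * ‖gradient (Φ' w.1) w.2‖ ^ 2 * Θ w.2 ^ 2) with hdd
  set Dp : ℕ → ℕ → ℝ≥0∞ := fun n m => ∫⁻ w in Icc (τ n m) (τ n (m + 1)) ×ˢ (univ : Set (EuclideanSpace ℝ (Fin 3))),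
    ENNReal.ofReal (1 / 2 * η w.1 * (deriv (deriv H) (Φ' w.1 w.2) * ‖gradient (Φ' w.1) w.2‖ ^ 2 *
      (Θ w.2 * φ n m w.2) ^ 2)) with hDp
  have hτstep : ∀ n, ∀ m < p n, τ n m ≤ τ n (m + 1) := fun n m _ => hτ n (Nat.le_succ m)
  have hpieceI : ∀ n m, m < p n → Icc (τ n m) (τ n (m + 1)) ×ˢ (univ : Set (EuclideanSpace ℝ (Fin 3))) ⊆
      Icc t₁ t₂ ×ˢ univ := fun n m hm =>
    prod_mono (Icc_subset_Icc ((hτI n m).1) ((hτI n (m + 1)).2)) Subset.rfl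
  -- ### finiteness of the cut dissipations
  have hDfin : ∀ n, ∀ m < p n, Dp n m ≠ ⊤ := fun n m hm => ((htel n 1 one_pos).1 m hm).ne
  have hDne : ∀ n, ∑ m ∈ Finset.range (p n), Dp n m ≠ ⊤ := fun n =>
    ENNReal.sum_ne_top.2 fun m hm => hDfin n m (Finset.mem_range.1 hm)
  have hDtoReal : ∀ n, (∑ m ∈ Finset.range (p n), Dp n m).toReal = ∑ m ∈ Finset.range (p n), (Dp n m).toReal :=
    fun n => ENNReal.toReal_sum fun m hm => hDfin n m (Finset.mem_range.1 hm)
  -- ### Fatou for the dissipation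
  have hDL : (∫⁻ w, ENNReal.ofReal (dd w) ∂μ) ≤ Filter.liminf (fun n => ∑ m ∈ Finset.range (p n), Dp n m) atTop := by
    have hF := lintegral_le_liminf_lintegral_indicator_compl (μ := μ) (f := fun w => ENNReal.ofReal (dd w)) mD hBadm hevBad
    refine hF.trans (Filter.liminf_le_liminf (Eventually.of_forall fun n => ?_))
    -- `∫⁻ 1_{Badᶜ} d ≤ Σ_m Dp n m`
    have hsplit := sum_setLIntegral_Icc_prod_univ (p n) (τ n) (hτstep n) (fun w => (Bad n)ᶜ.indicator (fun w => ENNReal.ofReal (dd w)) w)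
    rw [hτ0 n, hτp n] at hsplit
    rw [hμ, ← hsplit]
    refine Finset.sum_le_sum fun m hm => ?_
    have hm' := Finset.mem_range.1 hm
    set P : Set (ℝ × EuclideanSpace ℝ (Fin 3)) := Icc (τ n m) (τ n (m + 1)) ×ˢ (univ : Set (EuclideanSpace ℝ (Fin 3))) with hP
    have hPm : MeasurableSet P := measurableSet_Icc.prod MeasurableSet.univ
    calc (∫⁻ w in P, (Bad n)ᶜ.indicator (fun w => ENNReal.ofReal (dd w)) w)
        = ∫⁻ w in P, (Bad n ∪ Pᶜ)ᶜ.indicator (fun w => ENNReal.ofReal (dd w)) w := by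
          refine setLIntegral_congr_fun hPm (fun w hw => ?_)
          by_cases hwB : w ∈ Bad n
          · rw [indicator_of_notMem (Set.notMem_compl_iff.2 hwB),
              indicator_of_notMem (Set.notMem_compl_iff.2 (Set.mem_union_left _ hwB))]
          · rw [indicator_of_mem (mem_compl hwB), indicator_of_mem]
            rw [mem_compl_iff, mem_union, not_or]
            exact ⟨hwB, fun h => h hw⟩
      _ ≤ ∫⁻ w in P, ENNReal.ofReal (dd w * φ n m w.2 ^ 2) :=
          lintegral_indicator_compl_le_weight (D := dd) (φ := fun w : ℝ × EuclideanSpace ℝ (Fin 3) => φ n m w.2)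
            (B := Bad n ∪ Pᶜ) fun w hw => by
              rw [mem_union, not_or] at hw
              exact hφBad n m w (Set.notMem_compl_iff.1 hw.2).1 hw.1
      _ = Dp n m := by
          simp only [hDp, hP, hdd]
          refine lintegral_congr_ae (Eventually.of_forall fun w => ?_)
          beta_reduce
          congr 1
          ring
  -- ### dominated convergence for the drift and axis terms
  have hconv : ∀ (T : ℝ × EuclideanSpace ℝ (Fin 3) → ℝ), Integrable T μ →
      Tendsto (fun n => ∑ m ∈ Finset.range (p n), ∫ w in Icc (τ n m) (τ n (m + 1)) ×ˢ (univ : Set (EuclideanSpace ℝ (Fin 3))),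
        φ n m w.2 ^ 2 * T w) atTop (𝓝 (∫ w, T w ∂μ)) := by
    intro T hT
    have hδ := tendsto_integral_indicator_norm_zero hT hBadm hevBad
    refine tendsto_sub_nhds_zero_iff.1 (squeeze_zero_norm (fun n => ?_) hδ)
    -- `|Σ_m ∫_{P_m} φ²T - ∫ T| ≤ ∫ 1_{Bad} ‖T‖`
    have hsplitT := sum_setIntegral_Icc_prod_univ (p n) (τ n) (hτstep n) (f := T) (by rw [hτ0 n, hτp n]; exact hT)
    have hsplitB := sum_setIntegral_Icc_prod_univ (p n) (τ n) (hτstep n)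
      (f := fun w => (Bad n).indicator (fun w => ‖T w‖) w) (by rw [hτ0 n, hτp n]; exact (hT.norm.indicator (hBadm n)))
    rw [hτ0 n, hτp n] at hsplitT hsplitB
    rw [Real.norm_eq_abs, hμ, ← hsplitT, ← hsplitB, ← Finset.sum_sub_distrib]
    refine (Finset.abs_sum_le_sum_abs _ _).trans (Finset.sum_le_sum fun m hm => ?_)
    have hm' := Finset.mem_range.1 hm
    have hle : volume.restrict (Icc (τ n m) (τ n (m + 1)) ×ˢ (univ : Set (EuclideanSpace ℝ (Fin 3)))) ≤ μ :=
      Measure.restrict_mono (hpieceI n m hm') le_rfl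
    have hTm : Integrable T (volume.restrict (Icc (τ n m) (τ n (m + 1)) ×ˢ (univ : Set (EuclideanSpace ℝ (Fin 3))))) :=
      hT.mono_measure hle
    have hφT : Integrable (fun w : ℝ × EuclideanSpace ℝ (Fin 3) => φ n m w.2 ^ 2 * T w)
        (volume.restrict (Icc (τ n m) (τ n (m + 1)) ×ˢ (univ : Set (EuclideanSpace ℝ (Fin 3))))) := by
      refine hTm.bdd_mul (c := 1) ((((hφC n m).comp continuous_snd).pow 2).aestronglyMeasurable) ?_
      refine Eventually.of_forall fun w => ?_
      rw [Real.norm_eq_abs, abs_of_nonneg (sq_nonneg _)]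
      nlinarith [hφ0 n m w.2, hφ1 n m w.2]
    refine abs_integral_weight_sub_le hTm hφT (hBadm n) (fun w => hφ0 n m w.2) (fun w => hφ1 n m w.2) ?_
    filter_upwards [ae_restrict_mem (measurableSet_Icc.prod MeasurableSet.univ)] with w hw hwB
    exact hφBad n m w hw.1 hwB
  have hI₂ := hconv T2 iT2
  have hI₃ := hconv T3 iT3
  -- ### the error terms tend to zero
  have hεlim : Tendsto ε atTop (𝓝 0) := by rw [hε]; exact tendsto_one_div_add_atTop_nhds_zero_nat
  have hωε : Tendsto (fun n => ω (ε n)) atTop (𝓝 0) :=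
    hω.comp (tendsto_nhdsWithin_iff.2 ⟨hεlim, Eventually.of_forall fun n => hε0 n⟩)
  have hVsum : ∀ n, ∑ i ∈ s n, volume.real (ball (z n i).2 (4 * r n i)) ≤ 64 * vB * ε n := by
    intro n
    calc ∑ i ∈ s n, volume.real (ball (z n i).2 (4 * r n i)) ≤ ∑ i ∈ s n, 64 * vB * r n i :=
          Finset.sum_le_sum fun i hi => volumeReal_ball_four_mul_le _ (hr n i hi).1 (hr n i hi).2
      _ = 64 * vB * ∑ i ∈ s n, r n i := by rw [Finset.mul_sum]
      _ ≤ 64 * vB * ε n := mul_le_mul_of_nonneg_left (hsum n) (by positivity)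
  have hE₁ : Tendsto (fun n => 4 * ∑ m ∈ Finset.range (p n),
      ∫ w in Icc (τ n m) (τ n (m + 1)) ×ˢ (univ : Set (EuclideanSpace ℝ (Fin 3))),
        η w.1 * (H (Φ' w.1 w.2) * (Θ w.2 ^ 2 * ‖gradient (φ n m) w.2‖ ^ 2))) atTop (𝓝 0) := by
    refine squeeze_zero (fun n => ?_) (fun n => ?_) (by simpa using hωε.const_mul 4)
    · refine mul_nonneg (by norm_num) (Finset.sum_nonneg fun m _ => integral_nonneg fun w => ?_)
      exact mul_nonneg (hη0 _) (mul_nonneg (hH0 _) (mul_nonneg (sq_nonneg _) (sq_nonneg _)))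
    · exact mul_le_mul_of_nonneg_left (herr n).2.1 (by norm_num)
  have hE : Tendsto (fun n =>
      (∑ m ∈ Finset.range (p n), ∫ w in Icc (τ n m) (τ n (m + 1)) ×ˢ (univ : Set (EuclideanSpace ℝ (Fin 3))),
        η w.1 * (H (Φ' w.1 w.2) * |inner ℝ (U' w.1 w.2) ((Θ w.2 ^ 2) • gradient (fun y => φ n m y ^ 2) w.2)|)) +
      (∑ m ∈ Finset.range (p n), ∫ w in Icc (τ n m) (τ n (m + 1)) ×ˢ (univ : Set (EuclideanSpace ℝ (Fin 3))),
        η w.1 * (2 / cylRadius w.2 * (H (Φ' w.1 w.2) * |Θ w.2 ^ 2 * fderiv ℝ (fun y => φ n m y ^ 2) w.2 (eR w.2)|))) +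
      3 * (Cη' * (H 0 * CΘ ^ 2)) * ∑ i ∈ s n, volume.real (ball (z n i).2 (4 * r n i))) atTop (𝓝 0) := by
    have hlim : Tendsto (fun n => ω (ε n) + ω (ε n) + 3 * Kc * (64 * vB * ε n)) atTop (𝓝 0) := by
      have := (hωε.add hωε).add ((hεlim.const_mul (64 * vB)).const_mul (3 * Kc))
      simpa using this
    refine squeeze_zero (fun n => ?_) (fun n => ?_) hlim
    · refine add_nonneg (add_nonneg (Finset.sum_nonneg fun m _ => integral_nonneg fun w => ?_)
        (Finset.sum_nonneg fun m _ => integral_nonneg fun w => ?_))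
        (mul_nonneg (mul_nonneg (by norm_num) hKc0) (Finset.sum_nonneg fun i _ => measureReal_nonneg))
      · exact mul_nonneg (hη0 _) (mul_nonneg (hH0 _) (abs_nonneg _))
      · exact mul_nonneg (hη0 _) (mul_nonneg (div_nonneg zero_le_two (cylRadius_nonneg _))
          (mul_nonneg (hH0 _) (abs_nonneg _)))
    · have h2 := (herr n).2.2.1
      have h3 := (herr n).2.2.2
      have h4 := mul_le_mul_of_nonneg_left (hVsum n) (mul_nonneg (by norm_num : (0:ℝ) ≤ 3) hKc0)
      rw [hKc] at h4
      linarith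
  -- ### the abstract limit
  have hA0 : 0 ≤ η t₂ * ∫ x, H (Φ' t₂ x) * Θ x ^ 2 :=
    mul_nonneg (hη0 _) (integral_nonneg fun x => mul_nonneg (hH0 _) (sq_nonneg _))
  have hmain := energy_limit_of_cut_approximants (B := η t₁ * ∫ x, H (Φ' t₁ x) * Θ x ^ 2)
    (P₁ := 4 * ∫ w in Icc t₁ t₂ ×ˢ (univ : Set (EuclideanSpace ℝ (Fin 3))), η w.1 * (H (Φ' w.1 w.2) * ‖gradient Θ w.2‖ ^ 2))
    (P₄ := ∫ w in Icc t₁ t₂ ×ˢ (univ : Set (EuclideanSpace ℝ (Fin 3))), |deriv η w.1| * (H (Φ' w.1 w.2) * Θ w.2 ^ 2))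
    hA0 hDL hDne hI₂ hI₃ hE₁ hE (fun n σ hσ => by
      have h := (htel n σ hσ).2
      rw [hDtoReal n]
      have e2 : ∀ m, (∫ w in Icc (τ n m) (τ n (m + 1)) ×ˢ (univ : Set (EuclideanSpace ℝ (Fin 3))),
          η w.1 * (H (Φ' w.1 w.2) * (φ n m w.2 ^ 2 * inner ℝ (U' w.1 w.2) (gradient (fun y => Θ y ^ 2) w.2)))) =
          ∫ w in Icc (τ n m) (τ n (m + 1)) ×ˢ (univ : Set (EuclideanSpace ℝ (Fin 3))), φ n m w.2 ^ 2 * T2 w := by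
        intro m; refine integral_congr_ae (Eventually.of_forall fun w => ?_); simp only [hT2]; ring
      have e3 : ∀ m, (∫ w in Icc (τ n m) (τ n (m + 1)) ×ˢ (univ : Set (EuclideanSpace ℝ (Fin 3))),
          η w.1 * (2 / cylRadius w.2 * (H (Φ' w.1 w.2) * (φ n m w.2 ^ 2 * fderiv ℝ (fun y => Θ y ^ 2) w.2 (eR w.2))))) =
          ∫ w in Icc (τ n m) (τ n (m + 1)) ×ˢ (univ : Set (EuclideanSpace ℝ (Fin 3))), φ n m w.2 ^ 2 * T3 w := by
        intro m; refine integral_congr_ae (Eventually.of_forall fun w => ?_); simp only [hT3]; ring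
      simp only [e2, e3] at h
      linarith [h])
  simpa only [hμ, hdd, hT2, hT3] using hmain

end Summit.NavierStokesRegularity.NavierStokesRegularity.Theorems.AxisymmetricKatoGlobal.EulerScaling

end
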